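import Literature.Computability.AlgebraicComplexity.BorderApolarityLimits
import Literature.Computability.AlgebraicComplexity.BorderRankMatMulTwoCert
import Literature.Computability.AlgebraicComplexity.SchoenhageTau
import HarnessLib

/-!
# The degree-`≤ 3` border apolarity constraints of an approximate decomposition, over `K[ε]`

Topic `Literature/Computability/AlgebraicComplexity`.  Support file for the proof of
`Landsberg2005_borderRank_matMulTensor_two` (`BorderRankMatMulSmall.lean`).  An elementary
replacement, for the tree's ALGEBRAIC border rank (`IsApproxDecomposition`, `SchoenhageTau.lean`),
of the part of the border apolarity theorem (Buczyńska–Buczyński; Conner–Harper–Landsberg 2023,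
§2.3) that feeds the `(210)` and `(120)` tests of CHL 2023, §3.  Given `r` points
`(x_ρ(ε), y_ρ(ε)) ∈ A × B` over `K[ε]` (two slots of an approximate decomposition), over
`L = K(ε)`:

* `ev11`, `I11` — the bilinear forms on `A × B` vanishing at the points (`I₁₁₀,ε`), with
  `finrank_I11_ge : dim I11 ≥ ab − r`;
* `symA`, `ev21`, `I21` (forms of bidegree `(2,1)`, as symmetric tensors, vanishing at the points)
  and the mirror `symB`, `ev12`, `I12`; `finrank_I21_add_le` / `finrank_I12_add_le`:
  `dim I21 + r ≤ dim Sym` as soon as `r` symmetric test vectors have an invertible evaluation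
  matrix (general position);
* `map_mul210_limSub_le` / `map_mul120_limSub_le` — **multiplicativity survives the limit**:
  `(lim I11) · e_{a₀} ≤ lim I21` (CHL 2023, §2.3 (iii): "the multiplication maps … have image
  contained in `I_{ijk}`");
* `annSub t`, `limSub_I11_le_annSub` — **apolarity survives the limit**: if the points are two
  slots of an order-`h` approximate decomposition of `t`, then `lim I11 ≤ t(C*)^⊥`
  (CHL 2023, §2.3 (i): "`I₁₁₀ ⊂ T(C*)^⊥`");
* (general position by perturbation is the sibling `BorderApolarityPerturb.lean`).

## References

* A. Conner, A. Harper, J. M. Landsberg, *New lower bounds for matrix multiplication and `det₃`*,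
  Forum Math. Pi 11 (2023) e17 = arXiv:1911.07981, §2.3 (conditions (i)–(iii) on the limiting
  ideal), §3 (the tests). [ConnerHarperLandsberg2023]
-/

noncomputable section

open scoped BigOperators Polynomial
open Polynomial

namespace Literature.Computability.AlgebraicComplexity

universe u v

section Tests

variable {K : Type u} [Field K] (L : Type v) [Field L] [Algebra K[X] L]
variable {α β : Type} [Fintype α] [Fintype β]
variable {r : ℕ} (x : Fin r → α → K[X]) (y : Fin r → β → K[X])

/-! ### `(110)`: bilinear forms vanishing at the points -/

/-- Evaluation of a bilinear form `φ ∈ L^{A × B}` at the `ρ`-th point `(x_ρ, y_ρ)`.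
[cite: ConnerHarperLandsberg2023, §2.3] -/
def ev11 (ρ : Fin r) : (α × β → L) →ₗ[L] L where
  toFun φ := ∑ a, ∑ b, polyVec L (x ρ) a * polyVec L (y ρ) b * φ (a, b)
  map_add' φ ψ := by
    simp only [Pi.add_apply, mul_add, Finset.sum_add_distrib]
  map_smul' c φ := by
    simp only [Pi.smul_apply, smul_eq_mul, RingHom.id_apply, Finset.mul_sum]
    exact Finset.sum_congr rfl fun a _ => Finset.sum_congr rfl fun b _ => by ring

/-- Unfolding lemma for `ev11`. [folklore] -/
theorem ev11_apply (ρ : Fin r) (φ : α × β → L) :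
    ev11 L x y ρ φ = ∑ a, ∑ b, polyVec L (x ρ) a * polyVec L (y ρ) b * φ (a, b) := rfl

/-- `I₁₁₀,ε`: the bilinear forms over `L = K(ε)` vanishing at all the points.
[cite: ConnerHarperLandsberg2023, §2.3] -/
def I11 : Submodule L (α × β → L) := ⨅ ρ, LinearMap.ker (ev11 L x y ρ)

/-- Membership in `I11`. [folklore] -/
theorem mem_I11 {φ : α × β → L} : φ ∈ I11 L x y ↔ ∀ ρ, ev11 L x y ρ φ = 0 := by
  simp [I11, Submodule.mem_iInf]

/-- `dim I₁₁₀ ≥ ab − r` (`r` linear conditions). [cite: ConnerHarperLandsberg2023, §2.3 (ii)] -/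
theorem finrank_I11_ge :
    Fintype.card α * Fintype.card β ≤ Module.finrank L (I11 L x y) + r := by
  set E : (α × β → L) →ₗ[L] (Fin r → L) := LinearMap.pi fun ρ => ev11 L x y ρ with hE
  have hker : LinearMap.ker E = I11 L x y := by
    rw [hE, LinearMap.ker_pi]; rfl
  have h := LinearMap.finrank_range_add_finrank_ker E
  have hr : Module.finrank L (LinearMap.range E) ≤ r := by
    refine (Submodule.finrank_le _).trans ?_
    rw [Module.finrank_fintype_fun_eq_card, Fintype.card_fin]
  have hV : Module.finrank L (α × β → L) = Fintype.card α * Fintype.card β := by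
    rw [Module.finrank_fintype_fun_eq_card, Fintype.card_prod]
  rw [hker, hV] at h
  omega

/-! ### `(210)`: symmetric `(2,1)`-forms vanishing at the points -/

/-- Symmetric tensors in `A* ⊗ A* ⊗ B*` (the home of `S²A* ⊗ B*` in ordered coordinates).
[folklore] -/
def symA : Submodule L (α × α × β → L) where
  carrier := {γ | ∀ a a' b, γ (a, a', b) = γ (a', a, b)}
  add_mem' {γ δ} hγ hδ := fun a a' b => by simp only [Pi.add_apply, hγ a a' b, hδ a a' b]
  zero_mem' := fun a a' b => rfl
  smul_mem' c {γ} hγ := fun a a' b => by simp only [Pi.smul_apply, hγ a a' b]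

omit [Fintype α] [Fintype β] in
/-- Membership in `symA`. [folklore] -/
theorem mem_symA {γ : α × α × β → L} : γ ∈ symA L ↔ ∀ a a' b, γ (a, a', b) = γ (a', a, b) :=
  Iff.rfl

/-- Evaluation of a `(2,1)`-form at the `ρ`-th point. [cite: ConnerHarperLandsberg2023, §2.3] -/
def ev21 (ρ : Fin r) : (α × α × β → L) →ₗ[L] L where
  toFun γ := ∑ a, ∑ b, ∑ a', polyVec L (x ρ) a * polyVec L (x ρ) a' * polyVec L (y ρ) b * γ (a, a', b)
  map_add' γ δ := by
    simp only [Pi.add_apply, mul_add, Finset.sum_add_distrib]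
  map_smul' c γ := by
    simp only [Pi.smul_apply, smul_eq_mul, RingHom.id_apply, Finset.mul_sum]
    exact Finset.sum_congr rfl fun a _ => Finset.sum_congr rfl fun b _ =>
      Finset.sum_congr rfl fun a' _ => by ring

/-- Unfolding lemma for `ev21`. [folklore] -/
theorem ev21_apply (ρ : Fin r) (γ : α × α × β → L) : ev21 L x y ρ γ =
    ∑ a, ∑ b, ∑ a', polyVec L (x ρ) a * polyVec L (x ρ) a' * polyVec L (y ρ) b * γ (a, a', b) :=
  rfl

/-- `I₂₁₀,ε`: symmetric `(2,1)`-forms vanishing at all the points.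
[cite: ConnerHarperLandsberg2023, §2.3] -/
def I21 : Submodule L (α × α × β → L) := symA L ⊓ ⨅ ρ, LinearMap.ker (ev21 L x y ρ)

/-- Membership in `I21`. [folklore] -/
theorem mem_I21 {γ : α × α × β → L} :
    γ ∈ I21 L x y ↔ γ ∈ symA L ∧ ∀ ρ, ev21 L x y ρ γ = 0 := by
  simp [I21, Submodule.mem_inf, Submodule.mem_iInf]

/-- **General position for `(2,1)`-forms**: if `r` symmetric test vectors have an evaluation
matrix with nonzero determinant, the `r` conditions are independent on `Sym`, so
`dim I₂₁₀ + r ≤ dim Sym`. [cite: ConnerHarperLandsberg2023, §2.3 (ii)] -/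
theorem finrank_I21_add_le (γs : Fin r → (α × α × β → L)) (hsym : ∀ j, γs j ∈ symA L)
    (hdet : (Matrix.of fun ρ j => ev21 L x y ρ (γs j)).det ≠ 0) :
    Module.finrank L (I21 L x y) + r ≤ Module.finrank L (symA L (α := α) (β := β)) := by
  set E : symA L (α := α) (β := β) →ₗ[L] (Fin r → L) :=
    (LinearMap.pi fun ρ => ev21 L x y ρ).domRestrict (symA L) with hE
  have hrange : LinearMap.range E = ⊤ := by
    have hli : LinearIndependent L (fun j => E ⟨γs j, hsym j⟩) := by
      have hcols := Matrix.linearIndependent_cols_of_det_ne_zero hdet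
      have heq : (fun j => E ⟨γs j, hsym j⟩) = (Matrix.of fun ρ j => ev21 L x y ρ (γs j)).col := by
        funext j ρ; rfl
      rw [heq]; exact hcols
    have hspan : Submodule.span L (Set.range fun j => E ⟨γs j, hsym j⟩) = ⊤ :=
      Submodule.eq_top_of_finrank_eq (by
        rw [finrank_span_eq_card hli, Fintype.card_fin, Module.finrank_fintype_fun_eq_card,
          Fintype.card_fin])
    rw [eq_top_iff, ← hspan]
    exact Submodule.span_le.2 (by rintro _ ⟨j, rfl⟩; exact LinearMap.mem_range_self _ _)
  have hker : Module.finrank L (LinearMap.ker E) = Module.finrank L (I21 L x y) := by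
    have hk : LinearMap.ker E = (⨅ ρ, LinearMap.ker (ev21 L x y ρ)).comap (symA L).subtype := by
      rw [hE, LinearMap.ker_domRestrict, LinearMap.ker_pi]
    rw [hk, ← Submodule.finrank_map_subtype_eq (symA L), Submodule.map_comap_subtype]
    rfl
  have h := LinearMap.finrank_range_add_finrank_ker E
  rw [hrange, finrank_top, Module.finrank_fintype_fun_eq_card, Fintype.card_fin, hker] at h
  omega

/-! ### `(120)`: the mirror images -/

/-- Symmetric tensors in `A* ⊗ B* ⊗ B*`. [folklore] -/
def symB : Submodule L (α × β × β → L) where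
  carrier := {γ | ∀ a b b', γ (a, b, b') = γ (a, b', b)}
  add_mem' {γ δ} hγ hδ := fun a b b' => by simp only [Pi.add_apply, hγ a b b', hδ a b b']
  zero_mem' := fun a b b' => rfl
  smul_mem' c {γ} hγ := fun a b b' => by simp only [Pi.smul_apply, hγ a b b']

omit [Fintype α] [Fintype β] in
/-- Membership in `symB`. [folklore] -/
theorem mem_symB {γ : α × β × β → L} : γ ∈ symB L ↔ ∀ a b b', γ (a, b, b') = γ (a, b', b) :=
  Iff.rfl

/-- Evaluation of a `(1,2)`-form at the `ρ`-th point. [cite: ConnerHarperLandsberg2023, §2.3] -/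
def ev12 (ρ : Fin r) : (α × β × β → L) →ₗ[L] L where
  toFun γ := ∑ a, ∑ b, ∑ b', polyVec L (x ρ) a * polyVec L (y ρ) b * polyVec L (y ρ) b' * γ (a, b, b')
  map_add' γ δ := by
    simp only [Pi.add_apply, mul_add, Finset.sum_add_distrib]
  map_smul' c γ := by
    simp only [Pi.smul_apply, smul_eq_mul, RingHom.id_apply, Finset.mul_sum]
    exact Finset.sum_congr rfl fun a _ => Finset.sum_congr rfl fun b _ =>
      Finset.sum_congr rfl fun b' _ => by ring

/-- Unfolding lemma for `ev12`. [folklore] -/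
theorem ev12_apply (ρ : Fin r) (γ : α × β × β → L) : ev12 L x y ρ γ =
    ∑ a, ∑ b, ∑ b', polyVec L (x ρ) a * polyVec L (y ρ) b * polyVec L (y ρ) b' * γ (a, b, b') :=
  rfl

/-- `I₁₂₀,ε`: symmetric `(1,2)`-forms vanishing at all the points.
[cite: ConnerHarperLandsberg2023, §2.3] -/
def I12 : Submodule L (α × β × β → L) := symB L ⊓ ⨅ ρ, LinearMap.ker (ev12 L x y ρ)

/-- Membership in `I12`. [folklore] -/
theorem mem_I12 {γ : α × β × β → L} :
    γ ∈ I12 L x y ↔ γ ∈ symB L ∧ ∀ ρ, ev12 L x y ρ γ = 0 := by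
  simp [I12, Submodule.mem_inf, Submodule.mem_iInf]

/-- General position for `(1,2)`-forms: `dim I₁₂₀ + r ≤ dim Sym`.
[cite: ConnerHarperLandsberg2023, §2.3 (ii)] -/
theorem finrank_I12_add_le (γs : Fin r → (α × β × β → L)) (hsym : ∀ j, γs j ∈ symB L)
    (hdet : (Matrix.of fun ρ j => ev12 L x y ρ (γs j)).det ≠ 0) :
    Module.finrank L (I12 L x y) + r ≤ Module.finrank L (symB L (α := α) (β := β)) := by
  set E : symB L (α := α) (β := β) →ₗ[L] (Fin r → L) :=
    (LinearMap.pi fun ρ => ev12 L x y ρ).domRestrict (symB L) with hE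
  have hrange : LinearMap.range E = ⊤ := by
    have hli : LinearIndependent L (fun j => E ⟨γs j, hsym j⟩) := by
      have hcols := Matrix.linearIndependent_cols_of_det_ne_zero hdet
      have heq : (fun j => E ⟨γs j, hsym j⟩) = (Matrix.of fun ρ j => ev12 L x y ρ (γs j)).col := by
        funext j ρ; rfl
      rw [heq]; exact hcols
    have hspan : Submodule.span L (Set.range fun j => E ⟨γs j, hsym j⟩) = ⊤ :=
      Submodule.eq_top_of_finrank_eq (by
        rw [finrank_span_eq_card hli, Fintype.card_fin, Module.finrank_fintype_fun_eq_card,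
          Fintype.card_fin])
    rw [eq_top_iff, ← hspan]
    exact Submodule.span_le.2 (by rintro _ ⟨j, rfl⟩; exact LinearMap.mem_range_self _ _)
  have hker : Module.finrank L (LinearMap.ker E) = Module.finrank L (I12 L x y) := by
    have hk : LinearMap.ker E = (⨅ ρ, LinearMap.ker (ev12 L x y ρ)).comap (symB L).subtype := by
      rw [hE, LinearMap.ker_domRestrict, LinearMap.ker_pi]
    rw [hk, ← Submodule.finrank_map_subtype_eq (symB L), Submodule.map_comap_subtype]
    rfl
  have h := LinearMap.finrank_range_add_finrank_ker E
  rw [hrange, finrank_top, Module.finrank_fintype_fun_eq_card, Fintype.card_fin, hker] at h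
  omega

/-! ### Multiplicativity survives the limit: `(lim I₁₁₀) · e ≤ lim I₂₁₀`, `≤ lim I₁₂₀` -/

section Mult

variable [DecidableEq α] [DecidableEq β]

omit [Fintype α] [Fintype β] [DecidableEq β] in
/-- `polyVec` commutes with the `(210)` product. [folklore] -/
theorem polyVec_mul210 (a₀ : α) (f : α × β → K[X]) :
    polyVec L (MatMulTwo.mul210Fun K[X] a₀ f) = MatMulTwo.mul210Fun L a₀ (polyVec L f) := by
  funext t
  simp only [polyVec_apply, MatMulTwo.mul210Fun, map_add]
  split_ifs <;> simp

omit [Fintype α] [Fintype β] [DecidableEq α] in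
/-- `polyVec` commutes with the `(120)` product. [folklore] -/
theorem polyVec_mul120 (b₀ : β) (f : α × β → K[X]) :
    polyVec L (MatMulTwo.mul120Fun K[X] b₀ f) = MatMulTwo.mul120Fun L b₀ (polyVec L f) := by
  funext t
  simp only [polyVec_apply, MatMulTwo.mul120Fun, map_add]
  split_ifs <;> simp

omit [Fintype α] [Fintype β] [DecidableEq β] in
/-- Constant terms commute with the `(210)` product. [folklore] -/
theorem ev0_mul210 (a₀ : α) (f : α × β → K[X]) :
    ev0ₗ (MatMulTwo.mul210Fun K[X] a₀ f) = MatMulTwo.mul210Fun K a₀ (ev0ₗ f) := by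
  funext t
  simp only [ev0ₗ_apply, MatMulTwo.mul210Fun, coeff_add]
  split_ifs <;> simp

omit [Fintype α] [Fintype β] [DecidableEq α] in
/-- Constant terms commute with the `(120)` product. [folklore] -/
theorem ev0_mul120 (b₀ : β) (f : α × β → K[X]) :
    ev0ₗ (MatMulTwo.mul120Fun K[X] b₀ f) = MatMulTwo.mul120Fun K b₀ (ev0ₗ f) := by
  funext t
  simp only [ev0ₗ_apply, MatMulTwo.mul120Fun, coeff_add]
  split_ifs <;> simp

omit [Fintype α] [Fintype β] [DecidableEq β] in
/-- `(210)` products are symmetric tensors. [folklore] -/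
theorem mul210_mem_symA (a₀ : α) (φ : α × β → L) : MatMulTwo.mul210Fun L a₀ φ ∈ symA L := by
  intro a a' b
  simp only [MatMulTwo.mul210Fun]
  ring

omit [Fintype α] [Fintype β] [DecidableEq α] in
/-- `(120)` products are symmetric tensors. [folklore] -/
theorem mul120_mem_symB (b₀ : β) (φ : α × β → L) : MatMulTwo.mul120Fun L b₀ φ ∈ symB L := by
  intro a b b'
  simp only [MatMulTwo.mul120Fun]
  ring

omit [DecidableEq β] in
/-- Evaluating a `(210)` product: `ev21 (φ · e_{a₀}) = 2 x(a₀) · ev11 φ`. [folklore] -/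
theorem ev21_mul210 (ρ : Fin r) (a₀ : α) (φ : α × β → L) :
    ev21 L x y ρ (MatMulTwo.mul210Fun L a₀ φ) = 2 * polyVec L (x ρ) a₀ * ev11 L x y ρ φ := by
  simp only [ev21_apply, ev11_apply, MatMulTwo.mul210Fun, mul_add, Finset.sum_add_distrib, mul_ite,
    mul_zero, Finset.sum_ite_eq', Finset.mem_univ, if_true, Finset.sum_ite_irrel,
    Finset.sum_const_zero]
  rw [two_mul, add_mul, Finset.mul_sum]
  congr 1
  · refine Finset.sum_congr rfl fun a _ => ?_
    rw [Finset.mul_sum]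
    exact Finset.sum_congr rfl fun b _ => by ring
  · rw [Finset.sum_comm]
    refine Finset.sum_congr rfl fun a _ => ?_
    rw [Finset.mul_sum]
    exact Finset.sum_congr rfl fun b _ => by ring

omit [DecidableEq α] in
/-- Evaluating a `(120)` product: `ev12 (φ · e_{b₀}) = 2 y(b₀) · ev11 φ`. [folklore] -/
theorem ev12_mul120 (ρ : Fin r) (b₀ : β) (φ : α × β → L) :
    ev12 L x y ρ (MatMulTwo.mul120Fun L b₀ φ) = 2 * polyVec L (y ρ) b₀ * ev11 L x y ρ φ := by
  simp only [ev12_apply, ev11_apply, MatMulTwo.mul120Fun, mul_add, Finset.sum_add_distrib, mul_ite,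
    mul_zero, Finset.sum_ite_eq', Finset.mem_univ, if_true, Finset.sum_ite_irrel,
    Finset.sum_const_zero]
  rw [two_mul, add_mul, Finset.mul_sum]
  congr 1
  · refine Finset.sum_congr rfl fun a _ => ?_
    rw [Finset.mul_sum]
    exact Finset.sum_congr rfl fun b _ => by ring
  · refine Finset.sum_congr rfl fun a _ => ?_
    rw [Finset.mul_sum]
    exact Finset.sum_congr rfl fun b _ => by ring

omit [DecidableEq β] in
/-- The `(210)` product of a polynomial vector of `I₁₁₀` is a polynomial vector of `I₂₁₀`.
[cite: ConnerHarperLandsberg2023, §2.3 (iii)] -/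
theorem mul210_mem_latt {f : α × β → K[X]} (hf : f ∈ latt K L (I11 L x y)) (a₀ : α) :
    MatMulTwo.mul210Fun K[X] a₀ f ∈ latt K L (I21 L x y) := by
  rw [mem_latt, polyVec_mul210, mem_I21]
  refine ⟨mul210_mem_symA L a₀ _, fun ρ => ?_⟩
  have h0 : ev11 L x y ρ (polyVec L f) = 0 := (mem_I11 L x y).1 hf ρ
  rw [ev21_mul210, h0, mul_zero]

omit [DecidableEq α] in
/-- The `(120)` product of a polynomial vector of `I₁₁₀` is a polynomial vector of `I₁₂₀`.
[cite: ConnerHarperLandsberg2023, §2.3 (iii)] -/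
theorem mul120_mem_latt {f : α × β → K[X]} (hf : f ∈ latt K L (I11 L x y)) (b₀ : β) :
    MatMulTwo.mul120Fun K[X] b₀ f ∈ latt K L (I12 L x y) := by
  rw [mem_latt, polyVec_mul120, mem_I12]
  refine ⟨mul120_mem_symB L b₀ _, fun ρ => ?_⟩
  have h0 : ev11 L x y ρ (polyVec L f) = 0 := (mem_I11 L x y).1 hf ρ
  rw [ev12_mul120, h0, mul_zero]

omit [DecidableEq β] in
/-- **`(lim I₁₁₀) · e_{a₀} ≤ lim I₂₁₀`**: the `(210)` test constraint survives the limit.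
[cite: ConnerHarperLandsberg2023, §2.3 (iii)] -/
theorem map_mul210_limSub_le (a₀ : α) :
    (limSub K L (I11 L x y)).map (MatMulTwo.mul210 K a₀) ≤ limSub K L (I21 L x y) := by
  rintro _ ⟨φ, hφ, rfl⟩
  obtain ⟨f, hf, rfl⟩ := (mem_limSub_iff (K := K) L).1 hφ
  rw [MatMulTwo.mul210_apply, ← ev0_mul210]
  exact ev0_mem_limSub (K := K) L (mul210_mem_latt L x y hf a₀)

omit [DecidableEq α] in
/-- **`(lim I₁₁₀) · e_{b₀} ≤ lim I₁₂₀`**: the `(120)` test constraint survives the limit.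
[cite: ConnerHarperLandsberg2023, §2.3 (iii)] -/
theorem map_mul120_limSub_le (b₀ : β) :
    (limSub K L (I11 L x y)).map (MatMulTwo.mul120 K b₀) ≤ limSub K L (I12 L x y) := by
  rintro _ ⟨φ, hφ, rfl⟩
  obtain ⟨f, hf, rfl⟩ := (mem_limSub_iff (K := K) L).1 hφ
  rw [MatMulTwo.mul120_apply, ← ev0_mul120]
  exact ev0_mem_limSub (K := K) L (mul120_mem_latt L x y hf b₀)

end Mult

/-! ### Apolarity survives the limit: `lim I₁₁₀ ≤ t(C*)^⊥` -/

section Ann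

/-- `t(C*)^⊥ ⊂ A* ⊗ B*` for a coordinate tensor `t ∈ K^γ ⊗ K^α ⊗ K^β` (slot `γ` = `C`): the
bilinear forms annihilating every slice `t(c, ·, ·)`. [cite: ConnerHarperLandsberg2023, §2.3 (i)] -/
def annSub {γ : Type} (t : γ → α → β → K) : Submodule K (α × β → K) where
  carrier := {φ | ∀ c, ∑ a, ∑ b, φ (a, b) * t c a b = 0}
  add_mem' {φ ψ} hφ hψ := fun c => by
    simp only [Pi.add_apply, add_mul, Finset.sum_add_distrib, hφ c, hψ c, add_zero]
  zero_mem' := fun c => by simp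
  smul_mem' k {φ} hφ := fun c => by
    have h : k * ∑ a, ∑ b, φ (a, b) * t c a b = 0 := by rw [hφ c, mul_zero]
    rw [Finset.mul_sum] at h
    rw [← h]
    refine Finset.sum_congr rfl fun a _ => ?_
    rw [Finset.mul_sum]
    exact Finset.sum_congr rfl fun b _ => by simp [mul_assoc]

/-- Membership in `annSub`. [folklore] -/
theorem mem_annSub {γ : Type} {t : γ → α → β → K} {φ : α × β → K} :
    φ ∈ annSub t ↔ ∀ c, ∑ a, ∑ b, φ (a, b) * t c a b = 0 := Iff.rfl

variable [IsFractionRing K[X] L]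

/-- A polynomial vector of `I₁₁₀` vanishes at the points coefficientwise in `K[ε]`. [folklore] -/
theorem sum_eq_zero_of_mem_latt_I11 {f : α × β → K[X]} (hf : f ∈ latt K L (I11 L x y)) (ρ : Fin r) :
    ∑ a, ∑ b, x ρ a * y ρ b * f (a, b) = 0 := by
  apply IsFractionRing.injective K[X] L
  have h := (mem_I11 L x y).1 hf ρ
  rw [ev11_apply] at h
  rw [map_zero, ← h, map_sum]
  refine Finset.sum_congr rfl fun a _ => ?_
  rw [map_sum]
  refine Finset.sum_congr rfl fun b _ => ?_
  simp [polyVec_apply, map_mul]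

/-- **`lim I₁₁₀ ≤ t(C*)^⊥`**: if `(z_ρ, x_ρ, y_ρ)` is an order-`h` approximate decomposition of
`t`, every limit of bilinear forms vanishing at the points `(x_ρ, y_ρ)` annihilates `t(C*)`
(read off the coefficient of `εʰ`). [cite: ConnerHarperLandsberg2023, §2.3 (i)] -/
theorem limSub_I11_le_annSub {γ : Type} {t : γ → α → β → K} {h : ℕ} {z : Fin r → γ → K[X]}
    (hdec : IsApproxDecomposition h t z x y) : limSub K L (I11 L x y) ≤ annSub t := by
  intro φ hφ
  obtain ⟨f, hf, rfl⟩ := (mem_limSub_iff (K := K) L).1 hφ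
  intro c
  -- the polynomial identity `∑_{a,b} f(a,b) · (∑_ρ z_ρ(c) x_ρ(a) y_ρ(b)) = 0`
  have hpoly : ∑ a, ∑ b, f (a, b) * (∑ ρ, z ρ c * x ρ a * y ρ b) = 0 := by
    have h1 : ∀ ρ, ∑ a, ∑ b, x ρ a * y ρ b * f (a, b) = 0 := sum_eq_zero_of_mem_latt_I11 L x y hf
    calc ∑ a, ∑ b, f (a, b) * (∑ ρ, z ρ c * x ρ a * y ρ b)
        = ∑ a, ∑ b, ∑ ρ, z ρ c * (x ρ a * y ρ b * f (a, b)) := by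
          refine Finset.sum_congr rfl fun a _ => Finset.sum_congr rfl fun b _ => ?_
          rw [Finset.mul_sum]
          exact Finset.sum_congr rfl fun ρ _ => by ring
      _ = ∑ ρ, ∑ a, ∑ b, z ρ c * (x ρ a * y ρ b * f (a, b)) := by
          rw [show (∑ a, ∑ b, ∑ ρ, z ρ c * (x ρ a * y ρ b * f (a, b))) =
              ∑ a, ∑ ρ, ∑ b, z ρ c * (x ρ a * y ρ b * f (a, b)) from
            Finset.sum_congr rfl fun a _ => Finset.sum_comm]
          exact Finset.sum_comm
      _ = ∑ ρ, z ρ c * ∑ a, ∑ b, x ρ a * y ρ b * f (a, b) := by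
          refine Finset.sum_congr rfl fun ρ _ => ?_
          rw [Finset.mul_sum]
          exact Finset.sum_congr rfl fun a _ => by rw [Finset.mul_sum]
      _ = 0 := Finset.sum_eq_zero fun ρ _ => by rw [h1 ρ, mul_zero]
  -- its coefficient of `εʰ`
  have hcoeff := congrArg (fun P : K[X] => P.coeff h) hpoly
  simp only [finsetSum_coeff, coeff_zero] at hcoeff
  rw [← hcoeff]
  refine Finset.sum_congr rfl fun a _ => Finset.sum_congr rfl fun b _ => ?_
  have hlow : ∀ j < h, (∑ ρ, z ρ c * x ρ a * y ρ b).coeff j = 0 := by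
    intro j hj
    rw [hdec c a b j hj.le, if_neg hj.ne]
  rw [mul_comm (f (a, b)), coeff_mul_of_coeff_lt_eq_zero hlow, hdec c a b h le_rfl, if_pos rfl,
    ev0ₗ_apply, mul_comm]

end Ann


end Tests

end Literature.Computability.AlgebraicComplexity

end
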